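import Summits.QuantumFields.YangMills.Theses.RandomisedStokes
import HarnessLib

/-!
# Route `RandomisedStokes` (planner ym-r3-idea-2 g8, LINE 18 «randomised Stokes»), assembly item (stmt-QuantumFields-23888) — BY NAME

`MinimiserStabilityRegPr → FluctuationComparisonRegPrIntL → RectangleTailL → ChaosSuppressedDominationL → ThinDeepWindowTailL →
HistoryTailOfChaosL → YM3TorusSU2`: the glue `HistoryTailOfChaosL` turns the rectangle tail, the chaos-suppressed domination and the thin deep
residual into `UnitScaleTilt.HistoryTailL`, and the deciding theorem of route `UnitScaleTilt` combines it with the two R3 cruxes (19200, 20520)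
into the rung-R3 leaf.  Proof = the route's own deciding λ-term (`closes`).

Width seat ym-line-sfw-p2-w3 g32 (cell ym-idea-1, R3 family; free hands).  HONEST FRAMING: R3 (`YM3TorusSU2`) is a RECORD rung of LADDER-YM;
the cruxes `ChaosSuppressedDominationL` (XL), `RectangleTailL`, `ThinDeepWindowTailL`, the glue `HistoryTailOfChaosL`, 19200 and 20520 are
OPEN; this is plumbing of a draft route; no summit is proved and the Yang–Mills mass gap is NOT proved.
-/

set_option autoImplicit false

namespace Summit.QuantumFields.YangMills.Theorems

/-- **`RandomisedStokes.Assembly`** (item stmt-QuantumFields-23888) BY NAME: the six hypotheses compose to the leaf exactly as in the route's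
deciding theorem — `UnitScaleTilt.closes h200 h201 (hG hR hX hT)`. [folklore] -/
theorem randomisedStokes_assembly_proof :
    Summit.QuantumFields.YangMills.Theses.RandomisedStokes.Assembly :=
  fun h200 h201 hR hX hT hG => Summit.QuantumFields.YangMills.Theses.UnitScaleTilt.closes h200 h201 (hG hR hX hT)

end Summit.QuantumFields.YangMills.Theorems
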